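import Summits.BirchSwinnertonDyer.BirchSwinnertonDyer.Theorems.SignedLowerHalvesSmallImageLowerHalfBothSignsRttE2NumEulerTerm
import Summits.BirchSwinnertonDyer.BirchSwinnertonDyer.Theorems.SignedLowerHalvesSmallImageLowerHalfBothSignsRttE2NumLambdaCount
import HarnessLib

/-!
# Route `SignedLowerHalves`, crux L `SmallImageLowerHalfBothSigns` (item stmt-BirchSwinnertonDyer-23599), line `rtt_w3` —
# row **E2-num** of `Lines/rtt_w3-BRIEF-E2-g8.md` §2, part 4 (ASSEMBLY): for `f ∈ Λ_𝒪 = 𝒪⟦T⟧` whose image in `ℚ̄_p⟦T⟧` is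
# `c · L · ∏_{v∈S₀} P_v(u_v·(1+T)^{f_v})`, the module `Λ_𝒪/(f)` has
# `dim_E(E ⊗_𝒪 Λ_𝒪/(f)) = rank_𝒪((Λ_𝒪/(f))/tors) = D` and `dim_{ℚ_p}(ℚ_p ⊗_{ℤ_p} Λ_𝒪/(f)) = [E:ℚ_p]·D`,
# `D = d(L) + Σ_v p^{v_p(f_v)}·layerLambda(P_v.comp (C u_v * (X + 1)))` — the E2-tail's number

Width seat `bsd-line-slh-p3-w3` g19 under LEAD `cruxlead-stmt-BirchSwinnertonDyer-23599` g8 (cell `bsd-ssimc`); ROUTE-INDEPENDENT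
helper (`--supports stmt-BirchSwinnertonDyer-23599`); THEOREMS ONLY — no definition, no named fact, no instance, no `sorry`;
pure algebra; nothing about any Selmer group, zeta element, Coleman map or modular form is asserted; closes nothing; BSD is
not proved by any of this.

WHAT THIS GIVES THE LEAD'S §3 CHAIN (BRIEF-E2 rev 2 §3). The chain ends in `λ(X) ≥ λ(Λ_𝒪/(Col loc z_Σ))`; E2-an_Σ is to
identify `Col loc z_Σ =: f ∈ Λ_𝒪` with `c·L·∏_v 𝒫_v` read in `ℚ̄_p⟦T⟧` (`c ≠ 0` a constant, `L` the stub's Pollack-congruent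
series — it lives in `𝒪_g⟦T⟧`, a priori another coefficient ring, which is why the identity is phrased in `ℚ̄_p⟦T⟧` —,
`𝒫_v = P_v(u_v·(1+T)^{f_v})` the Euler-factor series). Given that identity as a HYPOTHESIS (`hf`), this file returns the
λ-count of `Λ_𝒪/(f)` in the three currencies in use: `dim_E(E ⊗_𝒪 ·)` (RTT@2's), `rank_𝒪(·/torsion)` (RTT@2's intrinsic
form, also on the carrier `IwasawaAlgebraO S`), and the crux's `dim_{ℚ_p}(ℚ_p ⊗_{ℤ_p} ·) = lambdaInvariant`-currency —
all equal to (`[E:ℚ_p]` times) the E2-tail's index `D`. Ingredients: part 3 `normLambda_C_mul_mul_prod_aeval` (the image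
of `f` attains its maximal coefficient norm first at `D`), RTT@2's `finrank_baseChange_quotient_span_eq_of_normLambda` /
`finrank_quotientTorsion_quotient_span_eq_of_normLambda[_iwasawaAlgebraO]` and part 2's
`finrank_padic_baseChange_quotient_span_eq_mul_of_normLambda`.

* `normLambda_of_map_eq` — transport of the two norm clauses (and `f ≠ 0`) from `ℚ̄_p⟦T⟧` to `f ∈ 𝒪_E⟦T⟧` along `hf`.
* **`finrank_quotient_span_eq_of_map_eq_eulerProduct`** (`𝒪 = unitBall p E`): the three counts `= D`, `= D`, `= [E:ℚ_p]·D`.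
* **`finrank_quotientTorsion_quotient_span_eq_of_eulerProduct_iwasawaAlgebraO`** (`𝒪 = padicCoeffIntegers S`,
  `Λ_𝒪 = IwasawaAlgebraO S`, hypothesis on `iwasawaOToPowerSeries S f`): `rank_𝒪((Λ_𝒪/(f))/tors) = D`.

References: [GreenbergVatsal2000] §2 Prop. (2.4), Cor. (2.3); [Washington1997] §7.1 Thm. 7.3, §13.2.
-/

set_option autoImplicit false
-- the Theorems namespace of this sub repeats the summit name by design (D-0017 nested layout)
set_option linter.dupNamespace false

noncomputable section

open scoped TensorProduct

open PowerSeries Literature.NumberTheory.IwasawaTheory Literature.NumberTheory.Automorphic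
open Summit.BirchSwinnertonDyer.BirchSwinnertonDyer.Theorems.LambdaLowerBoundO

namespace Summit.BirchSwinnertonDyer.BirchSwinnertonDyer.Theorems.SmallImageRttE2Num

variable (p : ℕ) [Fact p.Prime] (E : IntermediateField ℚ_[p] (PadicAlgCl p))

/-- Transport of the norm-λ clauses along `f ↦ f^{ℚ̄_p}`: if the image of `f ∈ 𝒪_E⟦T⟧` in `ℚ̄_p⟦T⟧` equals a series `φ`
attaining its maximal coefficient norm (positive) first at `D`, then `f ≠ 0` and the coefficients of `f` satisfy the two
clauses at `D`. [folklore] -/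
theorem normLambda_of_map_eq {f : PowerSeries (PadicIntermediateField.unitBall p E)} {φ : PowerSeries (PadicAlgCl p)}
    (hf : f.map (PadicIntermediateField.unitBall p E).subtype = φ) {D : ℕ} (hpos : 0 < ‖coeff D φ‖)
    (hle : ∀ k, ‖coeff k φ‖ ≤ ‖coeff D φ‖) (hlt : ∀ k, k < D → ‖coeff k φ‖ < ‖coeff D φ‖) :
    f ≠ 0 ∧
      (∀ k, ‖((coeff k f : PadicIntermediateField.unitBall p E) : PadicAlgCl p)‖ ≤
        ‖((coeff D f : PadicIntermediateField.unitBall p E) : PadicAlgCl p)‖) ∧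
      ∀ k, k < D → ‖((coeff k f : PadicIntermediateField.unitBall p E) : PadicAlgCl p)‖ <
        ‖((coeff D f : PadicIntermediateField.unitBall p E) : PadicAlgCl p)‖ := by
  have hco : ∀ k, ((coeff k f : PadicIntermediateField.unitBall p E) : PadicAlgCl p) = coeff k φ := fun k ↦ by
    rw [← hf, coeff_map]; rfl
  simp only [hco]
  refine ⟨fun h0 ↦ ?_, hle, hlt⟩
  have h := hco D
  rw [h0, map_zero, ZeroMemClass.coe_zero] at h
  rw [← h, norm_zero] at hpos
  exact lt_irrefl _ hpos

variable [FiniteDimensional ℚ_[p] E]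

/-- **E2-num assembled (`𝒪 = 𝒪_E`).** Let `f ∈ 𝒪_E⟦T⟧` have image `c · L · ∏_{v∈s} P_v(u_v·(1+T)^{f_v})` in `ℚ̄_p⟦T⟧`,
where `c ≠ 0`, `L ≠ 0` attains its maximal coefficient norm first at `d`, and for `v ∈ s`: `P_v ≠ 0` (polynomials over
`ℚ̄_p`), `u_v ≠ 0`, `f_v ∈ ℤ_p ∖ 0`. Put `D = d + Σ_{v∈s} p^{v_p(f_v)}·layerLambda(P_v.comp (C u_v * (X + 1)))`. Then
`dim_E(E ⊗_{𝒪_E} 𝒪_E⟦T⟧/(f)) = D`, `rank_{𝒪_E}((𝒪_E⟦T⟧/(f))/torsion) = D`, and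
`dim_{ℚ_p}(ℚ_p ⊗_{ℤ_p} 𝒪_E⟦T⟧/(f)) = [E:ℚ_p]·D`. (For the crux: `f = Col^ε(loc_v z_Σ)`, `u_v = ℓ_v⁻¹`,
`f_v = frobeniusExponent p ℓ_v`, `P_v = P_{g,ℓ_v}`; then `[E:ℚ_p]·D` is the left-hand side of the E2-tail.)
[cite: GreenbergVatsal2000, §2 Prop. (2.4) and Cor. (2.3)] [cite: Washington1997, §7.1 Thm. 7.3 and §13.2] -/
theorem finrank_quotient_span_eq_of_map_eq_eulerProduct {ι : Type*} (s : Finset ι)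
    (f : PowerSeries (PadicIntermediateField.unitBall p E)) {c : PadicAlgCl p} (hc : c ≠ 0)
    {L : PowerSeries (PadicAlgCl p)} (hL : L ≠ 0) {d : ℕ}
    (hle : ∀ k, ‖coeff k L‖ ≤ ‖coeff d L‖) (hlt : ∀ k, k < d → ‖coeff k L‖ < ‖coeff d L‖)
    (P : ι → Polynomial (PadicAlgCl p)) (u : ι → PadicAlgCl p) (fv : ι → ℤ_[p])
    (hP : ∀ v ∈ s, P v ≠ 0) (hu : ∀ v ∈ s, u v ≠ 0) (hfv : ∀ v ∈ s, fv v ≠ 0)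
    (hf : f.map (PadicIntermediateField.unitBall p E).subtype = C c * L *
      ∏ v ∈ s, Polynomial.aeval (C (u v) * (binomialSeries ℤ_[p] (fv v)).map (algebraMap ℤ_[p] (PadicAlgCl p))) (P v)) :
    let D : ℕ := d + ∑ v ∈ s, p ^ (fv v).valuation * layerLambda ((P v).comp (Polynomial.C (u v) * (Polynomial.X + 1)))
    Module.finrank E (E ⊗[PadicIntermediateField.unitBall p E]
        (PowerSeries (PadicIntermediateField.unitBall p E) ⧸ Ideal.span {f})) = D ∧
      Module.finrank (PadicIntermediateField.unitBall p E)
        ((PowerSeries (PadicIntermediateField.unitBall p E) ⧸ Ideal.span {f}) ⧸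
          Submodule.torsion (PadicIntermediateField.unitBall p E)
            (PowerSeries (PadicIntermediateField.unitBall p E) ⧸ Ideal.span {f})) = D ∧
      Module.finrank ℚ_[p] (ℚ_[p] ⊗[ℤ_[p]] (PowerSeries (PadicIntermediateField.unitBall p E) ⧸ Ideal.span {f})) =
        Module.finrank ℚ_[p] E * D := by
  intro D
  obtain ⟨hval, hleD, hltD⟩ := normLambda_C_mul_mul_prod_aeval s hc hL hle hlt P u fv hP hu hfv
  have hpos : 0 < ‖coeff D (C c * L * ∏ v ∈ s,
      Polynomial.aeval (C (u v) * (binomialSeries ℤ_[p] (fv v)).map (algebraMap ℤ_[p] (PadicAlgCl p))) (P v))‖ := by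
    rw [hval]
    refine mul_pos (mul_pos (norm_pos_iff.mpr hc) (norm_pos_iff.mpr fun h ↦ hL ?_)) ?_
    · exact (eq_zero_iff_coeff_eq_zero_of_normLambda hle).mpr h
    · refine Finset.prod_pos fun v hv ↦ lt_of_le_of_ne (Polynomial.supNorm_nonneg _) (Ne.symm ?_)
      exact (Polynomial.supNorm_eq_zero_iff _).not.mpr (comp_C_mul_X_add_one_ne_zero (hP v hv) (hu v hv))
  obtain ⟨hf0, hle', hlt'⟩ := normLambda_of_map_eq p E hf hpos hleD hltD
  exact ⟨finrank_baseChange_quotient_span_eq_of_normLambda p E f D hf0 hle' hlt',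
    finrank_quotientTorsion_quotient_span_eq_of_normLambda p E f D hf0 hle' hlt',
    finrank_padic_baseChange_quotient_span_eq_mul_of_normLambda p E f D hf0 hle' hlt'⟩

omit [FiniteDimensional ℚ_[p] E] in
/-- **E2-num assembled on the crux's carriers** (`𝒪 = padicCoeffIntegers S`, `Λ_𝒪 = IwasawaAlgebraO S`, `ℚ_p(S)/ℚ_p` finite):
if `iwasawaOToPowerSeries S f = c · L · ∏_{v∈s} P_v(u_v·(1+T)^{f_v})` with the data as in
`finrank_quotient_span_eq_of_map_eq_eulerProduct`, then `rank_𝒪((Λ_𝒪/(f))/torsion) = D`,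
`D = d + Σ_{v∈s} p^{v_p(f_v)}·layerLambda(P_v.comp (C u_v * (X + 1)))`. [cite: GreenbergVatsal2000, §2 Prop. (2.4)]
[cite: Washington1997, §7.1 Thm. 7.3 and §13.2] -/
theorem finrank_quotientTorsion_quotient_span_eq_of_eulerProduct_iwasawaAlgebraO (S : Set (PadicAlgCl p))
    [FiniteDimensional ℚ_[p] (Literature.NumberTheory.EllipticCurves.padicCoeffField S)] {ι : Type*} (s : Finset ι)
    {c : PadicAlgCl p} (hc : c ≠ 0) {L : PowerSeries (PadicAlgCl p)} (hL : L ≠ 0) {d : ℕ}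
    (hle : ∀ k, ‖coeff k L‖ ≤ ‖coeff d L‖) (hlt : ∀ k, k < d → ‖coeff k L‖ < ‖coeff d L‖)
    (P : ι → Polynomial (PadicAlgCl p)) (u : ι → PadicAlgCl p) (fv : ι → ℤ_[p])
    (hP : ∀ v ∈ s, P v ≠ 0) (hu : ∀ v ∈ s, u v ≠ 0) (hfv : ∀ v ∈ s, fv v ≠ 0) :
    ∀ f : Literature.NumberTheory.EllipticCurves.IwasawaAlgebraO S,
      Literature.NumberTheory.EllipticCurves.iwasawaOToPowerSeries S f = C c * L *
        ∏ v ∈ s, Polynomial.aeval (C (u v) * (binomialSeries ℤ_[p] (fv v)).map (algebraMap ℤ_[p] (PadicAlgCl p))) (P v) →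
      Module.finrank (Literature.NumberTheory.EllipticCurves.padicCoeffIntegers S)
        ((Literature.NumberTheory.EllipticCurves.IwasawaAlgebraO S ⧸ Ideal.span {f}) ⧸
          Submodule.torsion (Literature.NumberTheory.EllipticCurves.padicCoeffIntegers S)
            (Literature.NumberTheory.EllipticCurves.IwasawaAlgebraO S ⧸ Ideal.span {f})) =
        d + ∑ v ∈ s, p ^ (fv v).valuation * layerLambda ((P v).comp (Polynomial.C (u v) * (Polynomial.X + 1))) := by
  unfold Literature.NumberTheory.EllipticCurves.iwasawaOToPowerSeries Literature.NumberTheory.EllipticCurves.IwasawaAlgebraO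
  rw [Literature.NumberTheory.EllipticCurves.padicCoeffIntegers_eq_unitBall S]
  intro f hf
  exact (finrank_quotient_span_eq_of_map_eq_eulerProduct p _ s f hc hL hle hlt P u fv hP hu hfv hf).2.1

end Summit.BirchSwinnertonDyer.BirchSwinnertonDyer.Theorems.SmallImageRttE2Num

end
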